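import Summits.KontsevichZagierPeriods.KontsevichZagierPeriods.Theorems.IsometryMove.Negative.Kit

/-!
# `IsometryMove` (stmt-KontsevichZagierPeriods-3471) — negative side VI: the one-move (quaternion) line

Audit of the stubs of the crux skeleton `quaternion-difference-quotient` (registered 58ddc11ed261:
`stub_semialgebraic`, `stub_model`, `stub_sandwich`, `stub_sandwichDet`), all TRUE, with their
load-bearing hypotheses isolated: `not_sandwichDet_without_eps` (the frame-determinant stub needs
`ε = ±1`: `ε = 2`, `E = diag(1,2,1)`), `not_model_without_normalisation` (the quaternion model
`(aP+b)(cP+d)⁻¹ = (g p, 0)` needs the normalisation `s²(ad − bc) = 1`: `a = i`, `d = 1` gives `k ≠ j`);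
and the identities that make them true: `sandwich_identity` (the difference quotient of a Möbius
map in any division ring = `stub_sandwich` (1)), `moebius_derivFactor`
(`A − (AP+B)(CP+D)⁻¹C = (PC+D)⁻¹` for `CD = DC`, `AD − BC = 1`), `norm_swap`, `norm_derivFactor`
(`‖A − GC‖·‖(CP+D)⁻¹‖ = ‖CP+D‖⁻²`, reducing `stub_model` (4) to (3)); and `sandwichDet_holds` —
`stub_sandwichDet` itself, PROVED verbatim (polarization: `MᵀM = (‖L‖‖R‖)²·1`). [Beardon 1983, §4.1;
Benedetti–Petronio 1992, §A.4]
-/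

noncomputable section

open MeasureTheory Set MvPolynomial intervalIntegral
open Literature.NumberTheory.Transcendental Literature.ModelTheory.ExponentialFields

namespace Summit.KontsevichZagierPeriods.HyperbolicBloch.IsometryMoveNegative

open Summit.KontsevichZagierPeriods.KontsevichZagierPeriods (Theses.HyperbolicBloch.IsometryMove)

/-! ## §5' (gen 3) Targets: audit of the ACTIVE line `quaternion-difference-quotient`
(skeleton 58ddc11ed261, stubs `stub_semialgebraic`, `stub_model`, `stub_sandwich`, `stub_sandwichDet`;
none handed over as stuck). Verdict per stub, with the load-bearing hypothesis of each isolated: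

* `stub_sandwich` (1) — the quaternionic difference-quotient identity — is TRUE in every division
  ring: `sandwich_identity` below (sorry-free, 10 lines; the lead may copy it). (2) `HasFDerivAt` is
  routine from it (or from `hasFDerivAt_ring_inverse`, `ℍ` complete).
* `stub_sandwichDet` is TRUE for `ε = ±1` (the frame `x ↦ LxR` is `‖L‖‖R‖`·orthogonal on `ℍ = ℝ⁴`
  and preserves `span{1,i,j}` by hypothesis, so `E = ‖L‖‖R‖·O·diag(1,ε,1)`); its `ε`-hypothesis is
  LOAD-BEARING: `not_sandwichDet_without_eps` (`L = R = 1`, `ε = 2`, `E = diag(1,2,1)`, `|det E| = 2`).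
* `stub_model` is TRUE, and — notably — for EVERY real `ε` (no `ε = ±1` needed: `ε` only enters
  through `P = x + εy·i + t·j` on both sides). Its normalisation `s²(ad − bc) = 1` is LOAD-BEARING
  already for conjunct (3) (the `k`-component of `(aP+b)(cP+d)⁻¹` is `Im(ad−bc)·t/N`):
  `not_model_without_normalisation` (`a = i, d = 1, b = c = 0`, `p = (0,0,1)`: quaternion side
  `i·j = k`, typed side `j`). KEY IDENTITY for conjunct (4), PROVED here uniformly in `C`
  (`moebius_derivFactor`, any division ring, needs only `CD = DC` and `AD − BC = 1`):
  `A − (AP+B)(CP+D)⁻¹C = (PC + D)⁻¹`; with `‖PC + D‖ = ‖CP + D‖` (`norm_swap`) this gives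
  `norm_derivFactor : ‖A − GC‖·‖(CP+D)⁻¹‖ = ‖CP+D‖⁻²` (`= (|s|²N)⁻¹ = |ad−bc|/N = g₃/t`), i.e.
  `stub_model` (4) REDUCES to (3) plus norm bookkeeping — the lead may copy these three lemmas.
* `stub_semialgebraic` is TRUE (re/im of algebraic numbers are real algebraic, real algebraic
  constants are `ℚ`-definable; closure under field operations and `‖·‖` of a constant). Its
  algebraicity hypotheses ARE load-bearing for the stub (a transcendental translation `w ↦ w + π`
  has a non-`ℚ`-semialgebraic graph) though not for the truth of the crux (§4); no Lean refutation
  attempted (needs: a `ℚ`-semialgebraic point of `ℝ` is algebraic). -/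

/-- `stub_sandwich` (1) holds in every division ring: the quaternionic difference quotient of a
Möbius map. [folklore] -/
theorem sandwich_identity {K : Type*} [DivisionRing K] (A B C D p q : K)
    (hp : C * p + D ≠ 0) (hq : C * q + D ≠ 0) :
    (A * p + B) * (C * p + D)⁻¹ - (A * q + B) * (C * q + D)⁻¹ =
      (A - (A * q + B) * (C * q + D)⁻¹ * C) * (p - q) * (C * p + D)⁻¹ := by
  set G := (A * q + B) * (C * q + D)⁻¹ with hG
  have hGq : G * (C * q + D) = A * q + B := by rw [hG, inv_mul_cancel_right₀ hq]
  have hB : B = G * (C * q + D) - A * q := by rw [hGq, add_sub_cancel_left]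
  have key : (A - G * C) * (p - q) = (A * p + B) - G * (C * p + D) := by
    rw [hB]; noncomm_ring
  rw [key, sub_mul, mul_inv_cancel_right₀ hp]

/-- **KEY IDENTITY for `stub_model` (4)**, uniform in `C`, in every division ring: for scalars with
`CD = DC` and `AD − BC = 1` (in this order), `A − (AP+B)(CP+D)⁻¹C = (PC + D)⁻¹`. Proof: multiply by
`PC + D` on the right and use `C(PC + D) = (CP + D)C`. (For `C = 0` it reads `A = D⁻¹`.) [folklore] -/
theorem moebius_derivFactor {K : Type*} [DivisionRing K] (A B C D P : K)
    (hCD : C * D = D * C) (hdet : A * D - B * C = 1) (hP : C * P + D ≠ 0) :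
    A - (A * P + B) * (C * P + D)⁻¹ * C = (P * C + D)⁻¹ := by
  apply eq_inv_of_mul_eq_one_left
  have hY : C * (P * C + D) = (C * P + D) * C := by rw [mul_add, add_mul, hCD, mul_assoc]
  calc (A - (A * P + B) * (C * P + D)⁻¹ * C) * (P * C + D)
      = A * (P * C + D) - (A * P + B) * ((C * P + D)⁻¹ * (C * (P * C + D))) := by noncomm_ring
    _ = A * (P * C + D) - (A * P + B) * C := by rw [hY, inv_mul_cancel_left₀ hP]
    _ = A * D - B * C := by noncomm_ring
    _ = 1 := hdet

/-- `|PC + D|² = |CP + D|²` for a quaternion `P` and complex `C, D` (`Re(CP·D̄) = Re(P·D̄·C)`). [folklore] -/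
theorem normSq_swap (C D : ℂ) (P : Quaternion ℝ) :
    Quaternion.normSq (P * (C : Quaternion ℝ) + (D : Quaternion ℝ)) =
      Quaternion.normSq ((C : Quaternion ℝ) * P + (D : Quaternion ℝ)) := by
  simp only [Quaternion.normSq_def', Quaternion.re_add, Quaternion.imI_add, Quaternion.imJ_add,
    Quaternion.imK_add, Quaternion.re_mul, Quaternion.imI_mul, Quaternion.imJ_mul, Quaternion.imK_mul,
    Quaternion.re_coeComplex, Quaternion.imI_coeComplex, Quaternion.imJ_coeComplex,
    Quaternion.imK_coeComplex]
  ring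

/-- `‖PC + D‖ = ‖CP + D‖` for a quaternion `P` and complex `C, D`. [folklore] -/
theorem norm_swap (C D : ℂ) (P : Quaternion ℝ) :
    ‖P * (C : Quaternion ℝ) + (D : Quaternion ℝ)‖ = ‖(C : Quaternion ℝ) * P + (D : Quaternion ℝ)‖ := by
  have h := normSq_swap C D P
  rw [Quaternion.normSq_eq_norm_mul_self, Quaternion.normSq_eq_norm_mul_self] at h
  nlinarith [norm_nonneg (P * (C : Quaternion ℝ) + (D : Quaternion ℝ)),
    norm_nonneg ((C : Quaternion ℝ) * P + (D : Quaternion ℝ)), h]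

/-- **`stub_model` (4) reduces to (3):** for complex `A, B, C, D` with `AD − BC = 1` and a quaternion
`P` with `CP + D ≠ 0`, `‖A − (AP+B)(CP+D)⁻¹C‖ · ‖(CP+D)⁻¹‖ = ‖CP + D‖⁻²` (`= (|s|²N)⁻¹ = |ad−bc|/N =
g₃/t` for the normalised data `A = sa, …` of the stub). [folklore] -/
theorem norm_derivFactor (A B C D : ℂ) (P : Quaternion ℝ) (hdet : A * D - B * C = 1)
    (hP : (C : Quaternion ℝ) * P + (D : Quaternion ℝ) ≠ 0) :
    ‖(A : Quaternion ℝ) - ((A : Quaternion ℝ) * P + (B : Quaternion ℝ)) *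
          ((C : Quaternion ℝ) * P + (D : Quaternion ℝ))⁻¹ * (C : Quaternion ℝ)‖ *
        ‖((C : Quaternion ℝ) * P + (D : Quaternion ℝ))⁻¹‖ =
      (‖(C : Quaternion ℝ) * P + (D : Quaternion ℝ)‖ ^ 2)⁻¹ := by
  have hdet' : (A : Quaternion ℝ) * (D : Quaternion ℝ) - (B : Quaternion ℝ) * (C : Quaternion ℝ) = 1 := by
    rw [← Quaternion.coeComplex_mul, ← Quaternion.coeComplex_mul, ← Quaternion.coeComplex_one, ← hdet]
    ext <;> simp
  have hCD : (C : Quaternion ℝ) * (D : Quaternion ℝ) = (D : Quaternion ℝ) * (C : Quaternion ℝ) := by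
    rw [← Quaternion.coeComplex_mul, ← Quaternion.coeComplex_mul, mul_comm]
  rw [moebius_derivFactor _ _ _ _ _ hCD hdet' hP, norm_inv, norm_inv, norm_swap, ← mul_inv, sq]

/-- The `ε`-hypothesis of `stub_sandwichDet` is load-bearing: with `ε` free the frame statement is
false (`L = R = 1`, `ε = 2`, `E = diag(1, 2, 1)`: `|det E| = 2 ≠ 1 = (‖L‖‖R‖)³`). [folklore] -/
theorem not_sandwichDet_without_eps :
    ¬ ∀ (L R : Quaternion ℝ) (ε : ℝ) (E : (Fin 3 → ℝ) →L[ℝ] (Fin 3 → ℝ)),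
      (∀ v : Fin 3 → ℝ, L * ⟨v 0, ε * v 1, v 2, 0⟩ * R = ⟨E v 0, E v 1, E v 2, 0⟩) →
        |E.det| = (‖L‖ * ‖R‖) ^ 3 := by
  intro h
  let D : Fin 3 → ℝ := ![1, 2, 1]
  let E : (Fin 3 → ℝ) →L[ℝ] (Fin 3 → ℝ) :=
    LinearMap.toContinuousLinearMap (Matrix.toLin' (Matrix.diagonal D))
  have hE : ∀ v : Fin 3 → ℝ, ∀ i, E v i = D i * v i := fun v i => by
    simp [E, Matrix.mulVec_diagonal]
  have hdet : E.det = 2 := by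
    simp [E, ContinuousLinearMap.det, Matrix.det_diagonal, Fin.prod_univ_three, D]
  have h1 := h 1 1 2 E (fun v => by
    rw [one_mul, mul_one]
    ext <;> simp [hE, D])
  rw [hdet] at h1
  norm_num at h1

/-- `stub_model` with the normalisation `s² (ad − bc) = 1` weakened to `ad − bc ≠ 0` (and `s = 1`):
the verbatim conjunction for all admissible data. -/
def ModelWithoutNormalisation : Prop :=
  ∀ (a b c d : ℂ) (ε : ℝ), a * d - b * c ≠ 0 →
    ∀ (g : (Fin 3 → ℝ) → (Fin 3 → ℝ)),
      (∀ p, g p = ![(num a b c d ε p).re / den c d ε p, (num a b c d ε p).im / den c d ε p,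
        cruxHeight a b c d * p 2 / den c d ε p]) →
      ∀ (p : Fin 3 → ℝ), 0 < p 2 →
        0 < g p 2 ∧ ((c : ℂ) : Quaternion ℝ) * ⟨p 0, ε * p 1, p 2, 0⟩ + ((d : ℂ) : Quaternion ℝ) ≠ 0 ∧
        (((a : ℂ) : Quaternion ℝ) * ⟨p 0, ε * p 1, p 2, 0⟩ + ((b : ℂ) : Quaternion ℝ)) *
            (((c : ℂ) : Quaternion ℝ) * ⟨p 0, ε * p 1, p 2, 0⟩ + ((d : ℂ) : Quaternion ℝ))⁻¹ =
          ⟨g p 0, g p 1, g p 2, 0⟩ ∧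
        ‖((a : ℂ) : Quaternion ℝ) - ⟨g p 0, g p 1, g p 2, 0⟩ * ((c : ℂ) : Quaternion ℝ)‖ *
            ‖(((c : ℂ) : Quaternion ℝ) * ⟨p 0, ε * p 1, p 2, 0⟩ + ((d : ℂ) : Quaternion ℝ))⁻¹‖ =
          g p 2 / p 2

/-- **The normalisation of `stub_model` is load-bearing** (already for the model identity (3)):
`a = i`, `d = 1`, `b = c = 0`, `ε = 1`, `p = (0, 0, 1)`: `(iP)(1)⁻¹ = i·j = k` while the typed map
gives `(0, 0, ‖i‖) = j`. [folklore] -/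
theorem not_model_without_normalisation : ¬ ModelWithoutNormalisation := by
  intro h
  have h3 := (h Complex.I 0 0 1 1 (by simp) _ (fun p => rfl) ![0, 0, 1] (by simp)).2.2.1
  have hk := congrArg QuaternionAlgebra.imK h3
  simp only [Quaternion.coeComplex_zero, Quaternion.coeComplex_one, zero_mul, zero_add, add_zero,
    inv_one, mul_one] at hk
  simp [Quaternion.re_coeComplex, Quaternion.imI_coeComplex, Quaternion.imJ_coeComplex,
    Quaternion.imK_coeComplex] at hk

/-! ## The frame-determinant stub itself, PROVED (gen 3, positive by-product) -/

/-- `stub_sandwichDet` of the active line: a conformal quaternionic frame `v ↦ L·ι_ε(v)·R` that stays in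
`span{1,i,j}` has `|det| = (‖L‖‖R‖)³` (`ε = ±1`). Proof: `E` scales the Euclidean quadratic form by
`c² = (‖L‖‖R‖)²` (norm multiplicativity), hence `MᵀM = c²·1` by polarization, `det M² = c⁶`.
This DISCHARGES the stub as registered (skeleton 58ddc11ed261), verbatim. [folklore] -/
theorem sandwichDet_holds (L R : Quaternion ℝ) (ε : ℝ) (hε : ε = 1 ∨ ε = -1)
    (E : (Fin 3 → ℝ) →L[ℝ] (Fin 3 → ℝ))
    (hE : ∀ v : Fin 3 → ℝ, L * ⟨v 0, ε * v 1, v 2, 0⟩ * R = ⟨E v 0, E v 1, E v 2, 0⟩) :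
    |E.det| = (‖L‖ * ‖R‖) ^ 3 := by
  set c : ℝ := ‖L‖ * ‖R‖ with hc
  have hc0 : 0 ≤ c := mul_nonneg (norm_nonneg _) (norm_nonneg _)
  have hε2 : ε ^ 2 = 1 := by rcases hε with h | h <;> simp [h]
  -- (1) E scales the quadratic form Σ vᵢ² by c²
  have hQ : ∀ v : Fin 3 → ℝ,
      (E v 0) ^ 2 + (E v 1) ^ 2 + (E v 2) ^ 2 = c ^ 2 * ((v 0) ^ 2 + (v 1) ^ 2 + (v 2) ^ 2) := by
    intro v
    have h := congrArg Quaternion.normSq (hE v)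
    rw [map_mul, map_mul, Quaternion.normSq_eq_norm_mul_self L, Quaternion.normSq_eq_norm_mul_self R]
      at h
    simp only [Quaternion.normSq_def'] at h
    have : (E v 0) ^ 2 + (E v 1) ^ 2 + (E v 2) ^ 2 + 0 ^ 2 =
        ‖L‖ * ‖L‖ * ((v 0) ^ 2 + (ε * v 1) ^ 2 + (v 2) ^ 2 + 0 ^ 2) * (‖R‖ * ‖R‖) := h.symm
    rw [hc]
    linear_combination this + ‖L‖ ^ 2 * ‖R‖ ^ 2 * (v 1) ^ 2 * hε2
  -- (2) polarization: E preserves the dot product up to c²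
  have hB : ∀ v w : Fin 3 → ℝ,
      E v 0 * E w 0 + E v 1 * E w 1 + E v 2 * E w 2 = c ^ 2 * (v 0 * w 0 + v 1 * w 1 + v 2 * w 2) := by
    intro v w
    have h1 := hQ (v + w)
    simp only [map_add, Pi.add_apply] at h1
    linear_combination (h1 - hQ v - hQ w) / 2
  -- (3) the matrix of E is c·(orthogonal)
  set M : Matrix (Fin 3) (Fin 3) ℝ := LinearMap.toMatrix' (E : (Fin 3 → ℝ) →ₗ[ℝ] (Fin 3 → ℝ)) with hM
  have hMe : ∀ i j, M i j = E (Pi.single j 1) i := fun i j => by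
    rw [hM, LinearMap.toMatrix'_apply]
    rfl
  have hMM : M.transpose * M = (c ^ 2) • (1 : Matrix (Fin 3) (Fin 3) ℝ) := by
    ext i j
    simp only [Matrix.mul_apply, Matrix.transpose_apply, Fin.sum_univ_three, hMe, Matrix.smul_apply,
      smul_eq_mul]
    rw [hB]
    fin_cases i <;> fin_cases j <;> simp
  -- (4) determinants
  have hdet : E.det = M.det := by
    rw [hM, LinearMap.det_toMatrix']
  have hsq : M.det ^ 2 = (c ^ 3) ^ 2 := by
    have := congrArg Matrix.det hMM
    rw [Matrix.det_mul, Matrix.det_transpose, Matrix.det_smul, Matrix.det_one, Fintype.card_fin] at this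
    linear_combination this
  rw [hdet]
  have h2 : |M.det| ^ 2 = (c ^ 3) ^ 2 := by rw [sq_abs, hsq]
  exact (pow_left_inj₀ (abs_nonneg _) (by positivity) two_ne_zero).mp h2

end Summit.KontsevichZagierPeriods.HyperbolicBloch.IsometryMoveNegative

end
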